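import Literature.Computability.AlgebraicComplexity.MatMulPolystable
import Literature.Computability.AlgebraicComplexity.KempfNessClosedOrbit
import Literature.Computability.AlgebraicComplexity.TensorMomentEquivariance
import HarnessLib

/-!
# `⟨n,n,n⟩` is polystable (Bürgisser–Ikenmeyer 2017, Cor. 4.9): discharge

Sibling proof file of `Literature/Computability/AlgebraicComplexity/MatMulPolystable.lean`,
discharging its named fact
`Literature.Computability.AlgebraicComplexity.BurgisserIkenmeyer2017_cor49_matMulTensor`:
for every `n`, the orbit of the matrix multiplication tensor `matMulTensor ℂ n n n` under
`SL_{n²}(ℂ) × SL_{n²}(ℂ) × SL_{n²}(ℂ)` acting factorwise on `ℂ^{n×n} ⊗ ℂ^{n×n} ⊗ ℂ^{n×n}` is closed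
(P. Bürgisser, C. Ikenmeyer, *Fundamental invariants of orbit closures*, J. Algebra 477 (2017)
390–434 = arXiv:1511.02927, §4.2, Prop. 4.8 and Cor. 4.9; the result is attributed there to
K. Meyer's 2006 Diplomarbeit).

## Proof

The printed proof of Prop. 4.8 / Cor. 4.9 rests on three deep inputs absent from Mathlib: the
existence of a closed orbit in the boundary of a non-closed orbit, the Hilbert–Mumford criterion,
and its refinement by Luna (1975) and Kempf (1978) placing the destabilising one-parameter subgroup
in the centraliser of a reductive subgroup `R` of the stabiliser (for `⟨n,n,n⟩`: the torus of the
de Groote stabiliser, whose centraliser is the diagonal torus `T_m^3`); the subgroup is then killed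
by the *uniform marginals of the uniform distribution on the support*. We replace it by the
**Kempf–Ness route**, whose analytic half is already proved in the tree for the tensor power action
of ONE matrix (`KempfNessClosedOrbit.lean`, `isClosed_tensorOrbit_of_critical`: the `SL`-orbit of
a tensor with scalar moment matrix is closed), and a block-embedding reduction proved here:

1. **Embedding** (`emb3`, `word3`). A 3-tensor `t : τ → τ → τ → ℂ` (`τ = Fin n × Fin n`) is the
   `3`-tensor `emb3 t` over `τ × Fin 3` (`ℂ^{τ × Fin 3} = ℂ^τ ⊕ ℂ^τ ⊕ ℂ^τ`) supported on the
   *aligned* words `word3 a b c = (k ↦ ((a,b,c)_k, k))`. For any matrix `g` on `ℂ^{τ × Fin 3}`,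
   `(g • emb3 t) j = ∑ g (j 0) (a,0) g (j 1) (b,1) g (j 2) (c,2) t a b c` (`tensorAct_emb3_apply`),
   so block-diagonal matrices act through the factorwise **triple action** `tripleAct`
   (`tensorAct_blockDiagonal_emb3`) — the spelling of the named fact.
2. **Criticality** (`momentMatrix_emb3`). If the three one-leg Gram matrices of `t` are the same
   scalar, the moment matrix of `emb3 t` is scalar; for `⟨n,n,n⟩` all three equal `n · 1`
   (`gram_matMulTensor_fst/snd/thd` — the moment-map ("quantum marginal") form of the uniform
   marginals used in the printed proof). Hence the `SL(τ × Fin 3)`-orbit of `emb3 ⟨n,n,n⟩` is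
   closed, by the tree's Kempf–Ness theorem fed through
   `weightSum_tensorAct_eq_zero_of_momentMatrix_eq_smul_one` (`TensorMomentEquivariance.lean`).
3. **Cutting out the small orbit** (`eq_blockDiagonal_of_tensorAct_emb3`). If `det g = 1` and
   `g • emb3 t` is again an embedded tensor, then `g` is block diagonal, because `t = ⟨n,n,n⟩` is
   concise in each leg (`concise_matMulTensor_*`): the off-block entries of a block column of `g`
   are coefficients of a vanishing combination of slices of `t`, after peeling the other two legs
   by injectivity of `g` (`eq_zero_of_forall_sum_block_mul_eq_zero`). Its diagonal blocks have
   determinant product `1` and are renormalised to determinant `1` each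
   (`exists_tripleAct_eq_of_det_mul_eq_one`). So the preimage of the big closed orbit under the
   continuous injection `emb3` is exactly the `SL³`-orbit (`isClosed_tripleOrbit_of_gram`), which
   is therefore closed.

Everything here is elementary multilinear algebra and fully proved; the only external inputs are
the tree's Kempf–Ness files. Design: tensors are plain functions, all actions are finite sums (as
in `TensorPowerAction.lean`); the general statement `isClosed_tripleOrbit_of_gram` is kept for
arbitrary finite `τ` and any concise tensor with scalar Gram matrices (it applies verbatim to the
unit tensors `⟨m⟩` of Cor. 4.9, not vendored here).

## References

* P. Bürgisser, C. Ikenmeyer, *Fundamental invariants of orbit closures*, J. Algebra 477 (2017)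
  390–434; arXiv:1511.02927, §4.2, Prop. 4.8, Cor. 4.9. [BurgisserIkenmeyer2017]
* G. Kempf, L. Ness, *The length of vectors in representation spaces*, LNM 732 (1979), Thm. 0.1,
  Thm. 0.2.
* K. Meyer, *Polystabilität des Matrixmultiplikationstensors*, Diplomarbeit, Paderborn (2006), as
  cited in [BurgisserIkenmeyer2017].
-/

noncomputable section

open Finset Filter
open scoped Matrix Topology

namespace Literature.Computability.AlgebraicComplexity

section Word

variable {τ : Type*}

/-- The *aligned word* of a triple `(a, b, c)`: slot `k ∈ {0,1,2}` carries the letter of the `k`-th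
copy of `τ` inside `τ × Fin 3`, i.e. `k ↦ ((a,b,c)_k, k)`. [folklore] -/
def word3 (a b c : τ) : Fin 3 → τ × Fin 3 := fun k => (![a, b, c] k, k)

/-- Slot `0` of an aligned word. [folklore] -/
@[simp] theorem word3_zero (a b c : τ) : word3 a b c 0 = (a, 0) := rfl

/-- Slot `1` of an aligned word. [folklore] -/
@[simp] theorem word3_one (a b c : τ) : word3 a b c 1 = (b, 1) := rfl

/-- Slot `2` of an aligned word. [folklore] -/
@[simp] theorem word3_two (a b c : τ) : word3 a b c 2 = (c, 2) := rfl

/-- Aligned words are exactly the `word3 a b c`. [folklore] -/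
theorem word3_of_aligned {j : Fin 3 → τ × Fin 3} (h : ∀ k, (j k).2 = k) :
    word3 (j 0).1 (j 1).1 (j 2).1 = j := by
  funext k
  fin_cases k
  · exact Prod.ext rfl (h 0).symm
  · exact Prod.ext rfl (h 1).symm
  · exact Prod.ext rfl (h 2).symm

/-- `word3 a b c` is aligned: slot `k` carries a letter of the `k`-th copy of `τ`. [folklore] -/
theorem word3_aligned (a b c : τ) : ∀ k, (word3 a b c k).2 = k := fun _ => rfl

/-- `(a, b, c) ↦ word3 a b c` is injective. [folklore] -/
theorem word3_injective :
    Function.Injective (fun p : τ × τ × τ => word3 p.1 p.2.1 p.2.2) := by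
  rintro ⟨a, b, c⟩ ⟨a', b', c'⟩ h
  have h0 := congr_arg (fun w => (w 0).1) h
  have h1 := congr_arg (fun w => (w 1).1) h
  have h2 := congr_arg (fun w => (w 2).1) h
  simp only [word3_zero, word3_one, word3_two] at h0 h1 h2
  rw [h0, h1, h2]

/-- The **block embedding** of a 3-tensor `t : τ → τ → τ → ℂ` as a `3`-tensor over `τ × Fin 3`
(the three tensor factors `ℂ^τ` become the three summands of `ℂ^τ ⊕ ℂ^τ ⊕ ℂ^τ = ℂ^{τ × Fin 3}`):
`emb3 t (word3 a b c) = t a b c` and `emb3 t j = 0` on non-aligned words. [folklore] -/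
def emb3 (t : τ → τ → τ → ℂ) : (Fin 3 → τ × Fin 3) → ℂ :=
  fun j => if ∀ k, (j k).2 = k then t (j 0).1 (j 1).1 (j 2).1 else 0

/-- Unfolding `emb3`. [folklore] -/
theorem emb3_apply (t : τ → τ → τ → ℂ) (j : Fin 3 → τ × Fin 3) :
    emb3 t j = if ∀ k, (j k).2 = k then t (j 0).1 (j 1).1 (j 2).1 else 0 := rfl

/-- `emb3 t` on aligned words. [folklore] -/
@[simp] theorem emb3_word3 (t : τ → τ → τ → ℂ) (a b c : τ) : emb3 t (word3 a b c) = t a b c := by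
  rw [emb3_apply, if_pos (word3_aligned a b c)]
  rfl

/-- `emb3 t` vanishes off the aligned words. [folklore] -/
theorem emb3_of_not_aligned (t : τ → τ → τ → ℂ) {j : Fin 3 → τ × Fin 3} (h : ¬ ∀ k, (j k).2 = k) :
    emb3 t j = 0 := by
  rw [emb3_apply, if_neg h]

/-- `emb3` is injective. [folklore] -/
theorem emb3_injective : Function.Injective (emb3 : (τ → τ → τ → ℂ) → (Fin 3 → τ × Fin 3) → ℂ) := by
  intro t s h
  funext a b c
  have := congr_fun h (word3 a b c)
  simpa using this

/-- `emb3` is continuous. [folklore] -/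
theorem continuous_emb3 : Continuous (emb3 : (τ → τ → τ → ℂ) → (Fin 3 → τ × Fin 3) → ℂ) := by
  refine continuous_pi fun j => ?_
  by_cases h : ∀ k, (j k).2 = k
  · simp only [emb3_apply, if_pos h]
    exact (continuous_apply _).comp ((continuous_apply _).comp (continuous_apply _))
  · simp only [emb3_apply, if_neg h]
    exact continuous_const

end Word

section Triple

variable {τ : Type*} [Fintype τ]

/-- The **triple action** of three square matrices on a 3-tensor (factorwise change of basis):
`(A, B, C) • t = fun a b c => ∑ a' b' c', A a a' * B b b' * C c c' * t a' b' c'` — the spelling of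
`MatMulPolystable.lean`. [folklore] -/
def tripleAct (A B C : Matrix τ τ ℂ) (t : τ → τ → τ → ℂ) : τ → τ → τ → ℂ :=
  fun a b c => ∑ a', ∑ b', ∑ c', A a a' * B b b' * C c c' * t a' b' c'

/-- Unfolding `tripleAct`. [folklore] -/
theorem tripleAct_apply (A B C : Matrix τ τ ℂ) (t : τ → τ → τ → ℂ) (a b c : τ) :
    tripleAct A B C t a b c = ∑ a', ∑ b', ∑ c', A a a' * B b b' * C c c' * t a' b' c' := rfl

/-- Scalars pull out of the triple action factorwise. [folklore] -/
theorem tripleAct_smul (α β γ : ℂ) (A B C : Matrix τ τ ℂ) (t : τ → τ → τ → ℂ) :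
    tripleAct (α • A) (β • B) (γ • C) t = (α * β * γ) • tripleAct A B C t := by
  funext a b c
  simp only [tripleAct_apply, Pi.smul_apply, Matrix.smul_apply, smul_eq_mul, Finset.mul_sum]
  refine Finset.sum_congr rfl fun a' _ => Finset.sum_congr rfl fun b' _ =>
    Finset.sum_congr rfl fun c' _ => ?_
  ring

end Triple

section Sums

variable {τ : Type*} [Fintype τ] [DecidableEq τ]

/-- **Sums supported on aligned words are triple sums.** [folklore] -/
theorem sum_eq_sum_word3 {M : Type*} [AddCommMonoid M] (F : (Fin 3 → τ × Fin 3) → M)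
    (hF : ∀ j, (¬ ∀ k, (j k).2 = k) → F j = 0) :
    ∑ j, F j = ∑ a, ∑ b, ∑ c, F (word3 a b c) := by
  have hR : ∑ a, ∑ b, ∑ c, F (word3 a b c) =
      ∑ p : τ × τ × τ, F (word3 p.1 p.2.1 p.2.2) := by
    rw [Fintype.sum_prod_type]
    refine Finset.sum_congr rfl fun a _ => ?_
    rw [Fintype.sum_prod_type]
  rw [hR, ← Finset.sum_image (f := F) (s := (Finset.univ : Finset (τ × τ × τ)))
    (g := fun p : τ × τ × τ => word3 p.1 p.2.1 p.2.2) (fun x _ y _ h => word3_injective h)]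
  symm
  refine Finset.sum_subset (Finset.subset_univ _) fun j _ hj => hF j fun hal => hj ?_
  rw [Finset.mem_image]
  exact ⟨((j 0).1, (j 1).1, (j 2).1), Finset.mem_univ _, word3_of_aligned hal⟩

/-- **The tensor power action on embedded tensors**: for any `g` on `ℂ^{τ × Fin 3}`,
`(g • emb3 t) j = ∑ a b c, g (j 0) (a,0) g (j 1) (b,1) g (j 2) (c,2) t a b c`. [folklore] -/
theorem tensorAct_emb3_apply (g : Matrix (τ × Fin 3) (τ × Fin 3) ℂ) (t : τ → τ → τ → ℂ)
    (j : Fin 3 → τ × Fin 3) :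
    tensorAct g (emb3 t) j =
      ∑ a, ∑ b, ∑ c, g (j 0) (a, 0) * g (j 1) (b, 1) * g (j 2) (c, 2) * t a b c := by
  rw [tensorAct_apply, sum_eq_sum_word3 _ (fun i hi => by rw [emb3_of_not_aligned t hi, mul_zero])]
  refine Finset.sum_congr rfl fun a _ => Finset.sum_congr rfl fun b _ =>
    Finset.sum_congr rfl fun c _ => ?_
  rw [emb3_word3, Fin.prod_univ_three, word3_zero, word3_one, word3_two]

/-- **Block-diagonal matrices act through the triple action**:
`blockDiagonal M • emb3 t = emb3 ((M 0, M 1, M 2) • t)`. [folklore] -/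
theorem tensorAct_blockDiagonal_emb3 (M : Fin 3 → Matrix τ τ ℂ) (t : τ → τ → τ → ℂ) :
    tensorAct (Matrix.blockDiagonal M) (emb3 t) = emb3 (tripleAct (M 0) (M 1) (M 2) t) := by
  funext j
  rw [tensorAct_emb3_apply]
  by_cases hal : ∀ k, (j k).2 = k
  · rw [← word3_of_aligned hal, emb3_word3, tripleAct_apply]
    simp only [word3_zero, word3_one, word3_two, Matrix.blockDiagonal_apply_eq]
  · rw [emb3_of_not_aligned _ hal]
    by_cases h0 : (j 0).2 = 0
    · by_cases h1 : (j 1).2 = 1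
      · by_cases h2 : (j 2).2 = 2
        · exact absurd (fun k => by fin_cases k <;> assumption) hal
        · exact Finset.sum_eq_zero fun a _ => Finset.sum_eq_zero fun b _ =>
            Finset.sum_eq_zero fun c _ => by simp [Matrix.blockDiagonal_apply, h2]
      · exact Finset.sum_eq_zero fun a _ => Finset.sum_eq_zero fun b _ =>
          Finset.sum_eq_zero fun c _ => by simp [Matrix.blockDiagonal_apply, h1]
    · exact Finset.sum_eq_zero fun a _ => Finset.sum_eq_zero fun b _ =>
        Finset.sum_eq_zero fun c _ => by simp [Matrix.blockDiagonal_apply, h0]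

end Sums

/-! ### The moment matrix of an embedded tensor -/

section Moment

variable {τ : Type*} [Fintype τ] [DecidableEq τ]

omit [Fintype τ] [DecidableEq τ] in
/-- A property of `Fin 3` holds everywhere once it holds at `0`, `1`, `2`. [folklore] -/
theorem forall_fin_three_of {P : Fin 3 → Prop} (h0 : P 0) (h1 : P 1) (h2 : P 2) : ∀ k, P k := by
  intro k
  fin_cases k <;> assumption

omit [Fintype τ] [DecidableEq τ] in
/-- Replacing the letter in slot `0` of an aligned word by an aligned letter. [folklore] -/
theorem update_word3_zero (a b c y : τ) :
    Function.update (word3 a b c) 0 (y, 0) = word3 y b c := by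
  funext k
  by_cases hk : k = 0
  · subst hk
    rw [Function.update_self]
    rfl
  · rw [Function.update_of_ne hk]
    exact forall_fin_three_of (P := fun k => k ≠ 0 → word3 a b c k = word3 y b c k)
      (fun h => absurd rfl h) (fun _ => rfl) (fun _ => rfl) k hk

omit [Fintype τ] [DecidableEq τ] in
/-- Replacing the letter in slot `1` of an aligned word by an aligned letter. [folklore] -/
theorem update_word3_one (a b c y : τ) :
    Function.update (word3 a b c) 1 (y, 1) = word3 a y c := by
  funext k
  by_cases hk : k = 1
  · subst hk
    rw [Function.update_self]
    rfl
  · rw [Function.update_of_ne hk]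
    exact forall_fin_three_of (P := fun k => k ≠ 1 → word3 a b c k = word3 a y c k)
      (fun _ => rfl) (fun h => absurd rfl h) (fun _ => rfl) k hk

omit [Fintype τ] [DecidableEq τ] in
/-- Replacing the letter in slot `2` of an aligned word by an aligned letter. [folklore] -/
theorem update_word3_two (a b c y : τ) :
    Function.update (word3 a b c) 2 (y, 2) = word3 a b y := by
  funext k
  by_cases hk : k = 2
  · subst hk
    rw [Function.update_self]
    rfl
  · rw [Function.update_of_ne hk]
    exact forall_fin_three_of (P := fun k => k ≠ 2 → word3 a b c k = word3 a b y k)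
      (fun _ => rfl) (fun _ => rfl) (fun h => absurd rfl h) k hk

/-- Slots other than the block of the row index do not contribute to the moment matrix of an
embedded tensor. [folklore] -/
theorem slotSum_emb3_eq_zero_of_ne (t : τ → τ → τ → ℂ) {k kx : Fin 3} (hk : k ≠ kx) (x1 : τ)
    (y : τ × Fin 3) :
    ∑ j : Fin 3 → τ × Fin 3, (if j k = (x1, kx) then
      (starRingEnd ℂ) (emb3 t (Function.update j k y)) * emb3 t j else 0) = 0 := by
  refine Finset.sum_eq_zero fun j _ => ?_
  by_cases h : j k = (x1, kx)
  · rw [if_pos h]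
    have hal : ¬ ∀ k', (j k').2 = k' := fun hal => hk (by
      have := hal k
      rw [h] at this
      exact this.symm)
    rw [emb3_of_not_aligned t hal, mul_zero]
  · rw [if_neg h]

/-- Off-block column indices do not contribute either. [folklore] -/
theorem slotSum_emb3_eq_zero_of_ne' (t : τ → τ → τ → ℂ) {kx ky : Fin 3} (hk : ky ≠ kx) (x1 y1 : τ) :
    ∑ j : Fin 3 → τ × Fin 3, (if j kx = (x1, kx) then
      (starRingEnd ℂ) (emb3 t (Function.update j kx (y1, ky))) * emb3 t j else 0) = 0 := by
  refine Finset.sum_eq_zero fun j _ => ?_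
  by_cases h : j kx = (x1, kx)
  · rw [if_pos h]
    have hal : ¬ ∀ k', (Function.update j kx (y1, ky) k').2 = k' := fun hal => hk (by
      have := hal kx
      rwa [Function.update_self] at this)
    rw [emb3_of_not_aligned t hal, map_zero, zero_mul]
  · rw [if_neg h]

/-- The slot-`0` marginal of an embedded tensor. [folklore] -/
theorem slotSum_emb3_zero (t : τ → τ → τ → ℂ) (x1 y1 : τ) :
    ∑ j : Fin 3 → τ × Fin 3, (if j 0 = (x1, 0) then
      (starRingEnd ℂ) (emb3 t (Function.update j 0 (y1, 0))) * emb3 t j else 0) =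
      ∑ b, ∑ c, (starRingEnd ℂ) (t y1 b c) * t x1 b c := by
  have hvan : ∀ j : Fin 3 → τ × Fin 3, (¬ ∀ k, (j k).2 = k) → (if j 0 = (x1, 0) then
      (starRingEnd ℂ) (emb3 t (Function.update j 0 (y1, 0))) * emb3 t j else 0) = 0 :=
    fun j hj => by simp [emb3_of_not_aligned t hj]
  rw [sum_eq_sum_word3 _ hvan]
  simp only [word3_zero, update_word3_zero, emb3_word3, Prod.mk.injEq, and_true]
  rw [Finset.sum_eq_single x1]
  · simp
  · intro a _ ha
    simp [ha]
  · intro h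
    exact absurd (Finset.mem_univ _) h

/-- The slot-`1` marginal of an embedded tensor. [folklore] -/
theorem slotSum_emb3_one (t : τ → τ → τ → ℂ) (x1 y1 : τ) :
    ∑ j : Fin 3 → τ × Fin 3, (if j 1 = (x1, 1) then
      (starRingEnd ℂ) (emb3 t (Function.update j 1 (y1, 1))) * emb3 t j else 0) =
      ∑ a, ∑ c, (starRingEnd ℂ) (t a y1 c) * t a x1 c := by
  have hvan : ∀ j : Fin 3 → τ × Fin 3, (¬ ∀ k, (j k).2 = k) → (if j 1 = (x1, 1) then
      (starRingEnd ℂ) (emb3 t (Function.update j 1 (y1, 1))) * emb3 t j else 0) = 0 :=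
    fun j hj => by simp [emb3_of_not_aligned t hj]
  rw [sum_eq_sum_word3 _ hvan]
  simp only [word3_one, update_word3_one, emb3_word3, Prod.mk.injEq, and_true]
  refine Finset.sum_congr rfl fun a _ => ?_
  rw [Finset.sum_eq_single x1]
  · simp
  · intro b _ hb
    simp [hb]
  · intro h
    exact absurd (Finset.mem_univ _) h

/-- The slot-`2` marginal of an embedded tensor. [folklore] -/
theorem slotSum_emb3_two (t : τ → τ → τ → ℂ) (x1 y1 : τ) :
    ∑ j : Fin 3 → τ × Fin 3, (if j 2 = (x1, 2) then
      (starRingEnd ℂ) (emb3 t (Function.update j 2 (y1, 2))) * emb3 t j else 0) =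
      ∑ a, ∑ b, (starRingEnd ℂ) (t a b y1) * t a b x1 := by
  have hvan : ∀ j : Fin 3 → τ × Fin 3, (¬ ∀ k, (j k).2 = k) → (if j 2 = (x1, 2) then
      (starRingEnd ℂ) (emb3 t (Function.update j 2 (y1, 2))) * emb3 t j else 0) = 0 :=
    fun j hj => by simp [emb3_of_not_aligned t hj]
  rw [sum_eq_sum_word3 _ hvan]
  simp only [word3_two, update_word3_two, emb3_word3, Prod.mk.injEq, and_true]
  refine Finset.sum_congr rfl fun a _ => Finset.sum_congr rfl fun b _ => ?_
  rw [Finset.sum_eq_single x1]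
  · simp
  · intro c _ hc
    simp [hc]
  · intro h
    exact absurd (Finset.mem_univ _) h

/-- The diagonal-block marginals of an embedded tensor are the three Gram (marginal) matrices of
`t`. [folklore] -/
theorem slotSum_emb3_self (t : τ → τ → τ → ℂ) (cst : ℂ)
    (hG1 : ∀ a a' : τ, ∑ b, ∑ c, (starRingEnd ℂ) (t a' b c) * t a b c = if a = a' then cst else 0)
    (hG2 : ∀ b b' : τ, ∑ a, ∑ c, (starRingEnd ℂ) (t a b' c) * t a b c = if b = b' then cst else 0)
    (hG3 : ∀ c c' : τ, ∑ a, ∑ b, (starRingEnd ℂ) (t a b c') * t a b c = if c = c' then cst else 0)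
    (k : Fin 3) (x1 y1 : τ) :
    ∑ j : Fin 3 → τ × Fin 3, (if j k = (x1, k) then
      (starRingEnd ℂ) (emb3 t (Function.update j k (y1, k))) * emb3 t j else 0) =
      if x1 = y1 then cst else 0 := by
  fin_cases k
  · exact (slotSum_emb3_zero t x1 y1).trans (hG1 x1 y1)
  · exact (slotSum_emb3_one t x1 y1).trans (hG2 x1 y1)
  · exact (slotSum_emb3_two t x1 y1).trans (hG3 x1 y1)

/-- **The moment matrix of an embedded tensor with scalar Gram matrices is scalar**: if the three
one-leg marginals `∑_{bc} conj (t a' b c) t a b c` etc. of `t` all equal `cst · δ`, then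
`momentMatrix (emb3 t) = cst • 1` — i.e. `emb3 t` is a critical (moment-map-zero) vector for
`SU(τ × Fin 3)` (Kempf–Ness 1979 §1; Bürgisser–Ikenmeyer 2017, second hypothesis of Prop. 4.8 in
moment-map form). [folklore] -/
theorem momentMatrix_emb3 (t : τ → τ → τ → ℂ) {cst : ℂ}
    (hG1 : ∀ a a' : τ, ∑ b, ∑ c, (starRingEnd ℂ) (t a' b c) * t a b c = if a = a' then cst else 0)
    (hG2 : ∀ b b' : τ, ∑ a, ∑ c, (starRingEnd ℂ) (t a b' c) * t a b c = if b = b' then cst else 0)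
    (hG3 : ∀ c c' : τ, ∑ a, ∑ b, (starRingEnd ℂ) (t a b c') * t a b c = if c = c' then cst else 0) :
    momentMatrix (emb3 t) = cst • (1 : Matrix (τ × Fin 3) (τ × Fin 3) ℂ) := by
  ext ⟨x1, kx⟩ ⟨y1, ky⟩
  rw [momentMatrix_apply, Matrix.smul_apply, smul_eq_mul, Finset.sum_eq_single kx]
  · by_cases hk : ky = kx
    · subst hk
      rw [slotSum_emb3_self t cst hG1 hG2 hG3 ky x1 y1, Matrix.one_apply]
      by_cases hxy : x1 = y1
      · subst hxy
        simp
      · rw [if_neg hxy, if_neg (fun h => hxy (congrArg Prod.fst h)), mul_zero]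
    · rw [slotSum_emb3_eq_zero_of_ne' t hk x1 y1, Matrix.one_apply,
        if_neg (fun h => hk (congrArg Prod.snd h).symm), mul_zero]
  · intro k _ hk
    exact slotSum_emb3_eq_zero_of_ne t hk x1 (y1, ky)
  · intro h
    exact absurd (Finset.mem_univ _) h

end Moment

/-! ### Matrices mapping an embedded concise tensor into the embedded subspace are block diagonal -/

section BlockDiagonal

variable {τ : Type*} [Fintype τ] [DecidableEq τ]

omit [DecidableEq τ] in
/-- Multiplying by a vector supported in one block picks out that block of columns. [folklore] -/
theorem mulVec_blockPad (g : Matrix (τ × Fin 3) (τ × Fin 3) ℂ) (k : Fin 3) (u : τ → ℂ)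
    (z : τ × Fin 3) :
    g.mulVec (fun w => if w.2 = k then u w.1 else 0) z = ∑ b, g z (b, k) * u b := by
  simp only [Matrix.mulVec, dotProduct]
  rw [Fintype.sum_prod_type]
  refine Finset.sum_congr rfl fun b _ => ?_
  simp

omit [DecidableEq τ] in
/-- **Peeling one leg**: if `g` acts injectively and `∑ b, g z (b, k) * u b = 0` for all rows
`z`, then `u = 0`. [folklore] -/
theorem eq_zero_of_forall_sum_block_mul_eq_zero {g : Matrix (τ × Fin 3) (τ × Fin 3) ℂ}
    (hg : Function.Injective g.mulVec) (k : Fin 3) (u : τ → ℂ)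
    (h : ∀ z, ∑ b, g z (b, k) * u b = 0) : u = 0 := by
  have h0 : g.mulVec (fun w => if w.2 = k then u w.1 else 0) = 0 := by
    funext z
    rw [mulVec_blockPad, h z]
    rfl
  have h1 : (fun w : τ × Fin 3 => if w.2 = k then u w.1 else 0) = 0 :=
    hg (h0.trans (Matrix.mulVec_zero g).symm)
  funext b
  have := congr_fun h1 (b, k)
  simpa using this

/-- The value of `g • emb3 t` on the word `(x, z, w)`. [folklore] -/
theorem tensorAct_emb3_vec3 (g : Matrix (τ × Fin 3) (τ × Fin 3) ℂ) (t : τ → τ → τ → ℂ)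
    (x z w : τ × Fin 3) :
    tensorAct g (emb3 t) ![x, z, w] =
      ∑ a, ∑ b, ∑ c, g x (a, 0) * g z (b, 1) * g w (c, 2) * t a b c := by
  rw [tensorAct_emb3_apply]
  rfl

/-- First leg: if `g • emb3 t` is again embedded and `t` is `1`-concise, the first block column of
`g` is supported in the first block row. [folklore] -/
theorem apply_eq_zero_of_tensorAct_emb3_fst {g : Matrix (τ × Fin 3) (τ × Fin 3) ℂ}
    (hg : Function.Injective g.mulVec) {t s : τ → τ → τ → ℂ} (hts : tensorAct g (emb3 t) = emb3 s)
    (h1 : ∀ v : τ → ℂ, (∀ b c, ∑ a, v a * t a b c = 0) → v = 0)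
    {x : τ × Fin 3} (hx : x.2 ≠ 0) (a : τ) : g x (a, 0) = 0 := by
  have hP : ∀ z w : τ × Fin 3,
      ∑ a, ∑ b, ∑ c, g x (a, 0) * g z (b, 1) * g w (c, 2) * t a b c = 0 := by
    intro z w
    have hal : ¬ ∀ k, ((![x, z, w] : Fin 3 → τ × Fin 3) k).2 = k := fun h => hx (h 0)
    rw [← tensorAct_emb3_vec3, hts, emb3_of_not_aligned s hal]
  have hA : ∀ w : τ × Fin 3, ∀ b, ∑ a, ∑ c, g x (a, 0) * g w (c, 2) * t a b c = 0 := by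
    intro w
    have := eq_zero_of_forall_sum_block_mul_eq_zero hg 1
      (fun b => ∑ a, ∑ c, g x (a, 0) * g w (c, 2) * t a b c) ?_
    · exact fun b => congr_fun this b
    intro z
    rw [← hP z w]
    simp only [Finset.mul_sum]
    rw [Finset.sum_comm]
    refine Finset.sum_congr rfl fun a _ => Finset.sum_congr rfl fun b _ =>
      Finset.sum_congr rfl fun c _ => ?_
    ring
  have hB : ∀ b c, ∑ a, g x (a, 0) * t a b c = 0 := by
    intro b
    have := eq_zero_of_forall_sum_block_mul_eq_zero hg 2
      (fun c => ∑ a, g x (a, 0) * t a b c) ?_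
    · exact fun c => congr_fun this c
    intro w
    rw [← hA w b]
    simp only [Finset.mul_sum]
    rw [Finset.sum_comm]
    refine Finset.sum_congr rfl fun a _ => Finset.sum_congr rfl fun c _ => ?_
    ring
  exact congr_fun (h1 (fun a => g x (a, 0)) hB) a

/-- Second leg: the analogue of `apply_eq_zero_of_tensorAct_emb3_fst` for the middle block,
using `2`-conciseness of `t`. [folklore] -/
theorem apply_eq_zero_of_tensorAct_emb3_snd {g : Matrix (τ × Fin 3) (τ × Fin 3) ℂ}
    (hg : Function.Injective g.mulVec) {t s : τ → τ → τ → ℂ} (hts : tensorAct g (emb3 t) = emb3 s)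
    (h2 : ∀ v : τ → ℂ, (∀ a c, ∑ b, v b * t a b c = 0) → v = 0)
    {z : τ × Fin 3} (hz : z.2 ≠ 1) (b : τ) : g z (b, 1) = 0 := by
  have hP : ∀ x w : τ × Fin 3,
      ∑ a, ∑ b, ∑ c, g x (a, 0) * g z (b, 1) * g w (c, 2) * t a b c = 0 := by
    intro x w
    have hal : ¬ ∀ k, ((![x, z, w] : Fin 3 → τ × Fin 3) k).2 = k := fun h => hz (h 1)
    rw [← tensorAct_emb3_vec3, hts, emb3_of_not_aligned s hal]
  have hA : ∀ w : τ × Fin 3, ∀ a, ∑ b, ∑ c, g z (b, 1) * g w (c, 2) * t a b c = 0 := by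
    intro w
    have := eq_zero_of_forall_sum_block_mul_eq_zero hg 0
      (fun a => ∑ b, ∑ c, g z (b, 1) * g w (c, 2) * t a b c) ?_
    · exact fun a => congr_fun this a
    intro x
    rw [← hP x w]
    simp only [Finset.mul_sum]
    refine Finset.sum_congr rfl fun a _ => Finset.sum_congr rfl fun b _ =>
      Finset.sum_congr rfl fun c _ => ?_
    ring
  have hB : ∀ a c, ∑ b, g z (b, 1) * t a b c = 0 := by
    intro a
    have := eq_zero_of_forall_sum_block_mul_eq_zero hg 2
      (fun c => ∑ b, g z (b, 1) * t a b c) ?_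
    · exact fun c => congr_fun this c
    intro w
    rw [← hA w a]
    simp only [Finset.mul_sum]
    rw [Finset.sum_comm]
    refine Finset.sum_congr rfl fun b _ => Finset.sum_congr rfl fun c _ => ?_
    ring
  exact congr_fun (h2 (fun b => g z (b, 1)) hB) b

/-- Third leg: the analogue of `apply_eq_zero_of_tensorAct_emb3_fst` for the last block, using
`3`-conciseness of `t`. [folklore] -/
theorem apply_eq_zero_of_tensorAct_emb3_thd {g : Matrix (τ × Fin 3) (τ × Fin 3) ℂ}
    (hg : Function.Injective g.mulVec) {t s : τ → τ → τ → ℂ} (hts : tensorAct g (emb3 t) = emb3 s)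
    (h3 : ∀ v : τ → ℂ, (∀ a b, ∑ c, v c * t a b c = 0) → v = 0)
    {w : τ × Fin 3} (hw : w.2 ≠ 2) (c : τ) : g w (c, 2) = 0 := by
  have hP : ∀ x z : τ × Fin 3,
      ∑ a, ∑ b, ∑ c, g x (a, 0) * g z (b, 1) * g w (c, 2) * t a b c = 0 := by
    intro x z
    have hal : ¬ ∀ k, ((![x, z, w] : Fin 3 → τ × Fin 3) k).2 = k := fun h => hw (h 2)
    rw [← tensorAct_emb3_vec3, hts, emb3_of_not_aligned s hal]
  have hA : ∀ z : τ × Fin 3, ∀ a, ∑ b, ∑ c, g z (b, 1) * g w (c, 2) * t a b c = 0 := by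
    intro z
    have := eq_zero_of_forall_sum_block_mul_eq_zero hg 0
      (fun a => ∑ b, ∑ c, g z (b, 1) * g w (c, 2) * t a b c) ?_
    · exact fun a => congr_fun this a
    intro x
    rw [← hP x z]
    simp only [Finset.mul_sum]
    refine Finset.sum_congr rfl fun a _ => Finset.sum_congr rfl fun b _ =>
      Finset.sum_congr rfl fun c _ => ?_
    ring
  have hB : ∀ a b, ∑ c, g w (c, 2) * t a b c = 0 := by
    intro a
    have := eq_zero_of_forall_sum_block_mul_eq_zero hg 1
      (fun b => ∑ c, g w (c, 2) * t a b c) ?_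
    · exact fun b => congr_fun this b
    intro z
    rw [← hA z a]
    simp only [Finset.mul_sum]
    refine Finset.sum_congr rfl fun b _ => Finset.sum_congr rfl fun c _ => ?_
    ring
  exact congr_fun (h3 (fun c => g w (c, 2)) hB) c

/-- **Block diagonality.** If `g` is invertible, `g • emb3 t` lies in the embedded subspace, and
`t` is concise in each of its three legs, then `g` is block diagonal for `ℂ^{τ × Fin 3} =
ℂ^τ ⊕ ℂ^τ ⊕ ℂ^τ` (the images of the three flattenings of `g • emb3 t` are `g` applied to the three
summands). [folklore] -/
theorem eq_blockDiagonal_of_tensorAct_emb3 {g : Matrix (τ × Fin 3) (τ × Fin 3) ℂ}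
    (hg : Function.Injective g.mulVec) {t s : τ → τ → τ → ℂ} (hts : tensorAct g (emb3 t) = emb3 s)
    (h1 : ∀ v : τ → ℂ, (∀ b c, ∑ a, v a * t a b c = 0) → v = 0)
    (h2 : ∀ v : τ → ℂ, (∀ a c, ∑ b, v b * t a b c = 0) → v = 0)
    (h3 : ∀ v : τ → ℂ, (∀ a b, ∑ c, v c * t a b c = 0) → v = 0) :
    g = Matrix.blockDiagonal (fun k => Matrix.of fun a b => g (a, k) (b, k)) := by
  ext ⟨a, k⟩ ⟨b, k'⟩
  rw [Matrix.blockDiagonal_apply']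
  by_cases hk : k = k'
  · subst hk
    rw [if_pos rfl, Matrix.of_apply]
  · rw [if_neg hk]
    exact forall_fin_three_of (P := fun k' => k ≠ k' → g (a, k) (b, k') = 0)
      (fun h => apply_eq_zero_of_tensorAct_emb3_fst hg hts h1 h b)
      (fun h => apply_eq_zero_of_tensorAct_emb3_snd hg hts h2 h b)
      (fun h => apply_eq_zero_of_tensorAct_emb3_thd hg hts h3 h b) k' hk

end BlockDiagonal

/-! ### Closedness of the `SL × SL × SL`-orbit -/

section Closed

variable {τ : Type*} [Fintype τ] [DecidableEq τ]

/-- **Determinant renormalisation**: a triple `(A, B, C)` with `det A · det B · det C = 1` acts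
on every tensor like a triple of determinant-one matrices (rescale by `card τ`-th roots).
[folklore] -/
theorem exists_tripleAct_eq_of_det_mul_eq_one (A B C : Matrix τ τ ℂ)
    (h : A.det * B.det * C.det = 1) (t : τ → τ → τ → ℂ) :
    ∃ A' B' C' : Matrix τ τ ℂ, A'.det = 1 ∧ B'.det = 1 ∧ C'.det = 1 ∧
      tripleAct A' B' C' t = tripleAct A B C t := by
  classical
  rcases Nat.eq_zero_or_pos (Fintype.card τ) with h0 | hpos
  · haveI : IsEmpty τ := Fintype.card_eq_zero_iff.mp h0
    exact ⟨A, B, C, Matrix.det_isEmpty, Matrix.det_isEmpty, Matrix.det_isEmpty, rfl⟩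
  · have hA : A.det ≠ 0 := by
      intro hA
      rw [hA, zero_mul, zero_mul] at h
      exact zero_ne_one h
    have hB : B.det ≠ 0 := by
      intro hB
      rw [hB, mul_zero, zero_mul] at h
      exact zero_ne_one h
    obtain ⟨α, hα⟩ := IsAlgClosed.exists_pow_nat_eq (A.det)⁻¹ hpos
    obtain ⟨β, hβ⟩ := IsAlgClosed.exists_pow_nat_eq (B.det)⁻¹ hpos
    have hα0 : α ≠ 0 := by
      rintro rfl
      rw [zero_pow hpos.ne'] at hα
      exact inv_ne_zero hA hα.symm
    have hβ0 : β ≠ 0 := by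
      rintro rfl
      rw [zero_pow hpos.ne'] at hβ
      exact inv_ne_zero hB hβ.symm
    refine ⟨α • A, β • B, (α * β)⁻¹ • C, ?_, ?_, ?_, ?_⟩
    · rw [Matrix.det_smul, hα, inv_mul_cancel₀ hA]
    · rw [Matrix.det_smul, hβ, inv_mul_cancel₀ hB]
    · rw [Matrix.det_smul, inv_pow, mul_pow, hα, hβ, mul_inv, inv_inv, inv_inv, h]
    · rw [tripleAct_smul, mul_inv_cancel₀ (mul_ne_zero hα0 hβ0), one_smul]

/-- **Closed `SL³`-orbits of critical concise tensors** (Kempf–Ness for the triple action,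
reduced to the tree's `isClosed_tensorOrbit_of_critical`): if the three one-leg Gram matrices
of `t : τ → τ → τ → ℂ` are the same scalar `cst` and `t` is concise in each leg, then the orbit
`{(A, B, C) • t | det A = det B = det C = 1}` is closed in the classical topology. Proof: the
`SL(τ × Fin 3)`-orbit of the critical tensor `emb3 t` is closed (Kempf–Ness 1979, Thm. 0.2, in the
tree's elementary form); its preimage under the closed embedding `emb3` is the `SL³`-orbit, because
a matrix of determinant `1` mapping `emb3 t` into the embedded subspace is block diagonal
(`eq_blockDiagonal_of_tensorAct_emb3`) with blocks of determinant product `1`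
(`exists_tripleAct_eq_of_det_mul_eq_one`). [folklore] -/
theorem isClosed_tripleOrbit_of_gram (t : τ → τ → τ → ℂ) {cst : ℂ}
    (hG1 : ∀ a a' : τ, ∑ b, ∑ c, (starRingEnd ℂ) (t a' b c) * t a b c = if a = a' then cst else 0)
    (hG2 : ∀ b b' : τ, ∑ a, ∑ c, (starRingEnd ℂ) (t a b' c) * t a b c = if b = b' then cst else 0)
    (hG3 : ∀ c c' : τ, ∑ a, ∑ b, (starRingEnd ℂ) (t a b c') * t a b c = if c = c' then cst else 0)
    (h1 : ∀ v : τ → ℂ, (∀ b c, ∑ a, v a * t a b c = 0) → v = 0)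
    (h2 : ∀ v : τ → ℂ, (∀ a c, ∑ b, v b * t a b c = 0) → v = 0)
    (h3 : ∀ v : τ → ℂ, (∀ a b, ∑ c, v c * t a b c = 0) → v = 0) :
    IsClosed {s : τ → τ → τ → ℂ | ∃ A B C : Matrix τ τ ℂ,
      A.det = 1 ∧ B.det = 1 ∧ C.det = 1 ∧ tripleAct A B C t = s} := by
  have hmom := momentMatrix_emb3 t hG1 hG2 hG3
  have hbig : IsClosed {S : (Fin 3 → τ × Fin 3) → ℂ |
      ∃ g : Matrix (τ × Fin 3) (τ × Fin 3) ℂ, g.det = 1 ∧ tensorAct g (emb3 t) = S} :=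
    isClosed_tensorOrbit_of_critical (emb3 t) fun U hU θ hθ =>
      weightSum_tensorAct_eq_zero_of_momentMatrix_eq_smul_one hmom hU θ hθ
  have hpre := hbig.preimage (continuous_emb3 (τ := τ))
  convert hpre using 1
  ext s
  simp only [Set.mem_setOf_eq, Set.mem_preimage]
  constructor
  · rintro ⟨A, B, C, hA, hB, hC, rfl⟩
    refine ⟨Matrix.blockDiagonal ![A, B, C], ?_, ?_⟩
    · rw [Matrix.det_blockDiagonal, Fin.prod_univ_three]
      simp [hA, hB, hC]
    · rw [tensorAct_blockDiagonal_emb3]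
      rfl
  · rintro ⟨g, hg, hgs⟩
    have hginj : Function.Injective g.mulVec :=
      Matrix.mulVec_injective_iff_isUnit.mpr
        ((Matrix.isUnit_iff_isUnit_det g).mpr (hg ▸ isUnit_one))
    set M : Fin 3 → Matrix τ τ ℂ := fun k => Matrix.of fun a b => g (a, k) (b, k) with hM
    have hgM : g = Matrix.blockDiagonal M :=
      eq_blockDiagonal_of_tensorAct_emb3 hginj hgs h1 h2 h3
    have hdet : (M 0).det * (M 1).det * (M 2).det = 1 := by
      rw [← Fin.prod_univ_three (fun k => (M k).det), ← Matrix.det_blockDiagonal, ← hgM, hg]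
    have hs : s = tripleAct (M 0) (M 1) (M 2) t := by
      apply emb3_injective
      rw [← hgs, hgM, tensorAct_blockDiagonal_emb3]
    obtain ⟨A', B', C', hA', hB', hC', heq⟩ :=
      exists_tripleAct_eq_of_det_mul_eq_one (M 0) (M 1) (M 2) hdet t
    exact ⟨A', B', C', hA', hB', hC', heq.trans hs.symm⟩

end Closed

/-! ### The matrix multiplication tensor: Gram matrices and conciseness -/

section MatMul

variable (n : ℕ)

/-- Products of indicators. [folklore] -/
theorem conj_indicator_mul_indicator (P Q : Prop) [Decidable P] [Decidable Q] :
    (starRingEnd ℂ) (if P then 1 else 0) * (if Q then (1 : ℂ) else 0) =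
      if P ∧ Q then 1 else 0 := by
  by_cases hp : P <;> by_cases hq : Q <;> simp [hp, hq]

/-- Unfolding `matMulTensor ℂ n n n`. [folklore] -/
theorem matMulTensor_apply_eq (a b c : Fin n × Fin n) :
    matMulTensor ℂ n n n a b c = if a.1 = b.1 ∧ b.2 = c.1 ∧ a.2 = c.2 then 1 else 0 := rfl

/-- The row count `#{b : Fin n × Fin n | b.1 = i} = n`, as a complex sum. [folklore] -/
theorem sum_indicator_fst_eq_natCast (i : Fin n) :
    ∑ b : Fin n × Fin n, (if i = b.1 then (1 : ℂ) else 0) = n := by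
  rw [Fintype.sum_prod_type, Finset.sum_comm]
  simp

/-- The column count `#{b : Fin n × Fin n | b.2 = i} = n`, as a complex sum. [folklore] -/
theorem sum_indicator_snd_eq_natCast (i : Fin n) :
    ∑ b : Fin n × Fin n, (if b.2 = i then (1 : ℂ) else 0) = n := by
  rw [Fintype.sum_prod_type]
  simp

/-- **First Gram matrix of `⟨n,n,n⟩`**: `∑_{b,c} conj ⟨n,n,n⟩_{a'bc} ⟨n,n,n⟩_{abc} = n δ_{aa'}`
(uniform first marginal; Bürgisser–Ikenmeyer 2017, proof of Cor. 4.9). [folklore] -/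
theorem gram_matMulTensor_fst (a a' : Fin n × Fin n) :
    ∑ b, ∑ c, (starRingEnd ℂ) (matMulTensor ℂ n n n a' b c) * matMulTensor ℂ n n n a b c =
      if a = a' then (n : ℂ) else 0 := by
  simp only [matMulTensor_apply_eq, conj_indicator_mul_indicator]
  by_cases haa : a = a'
  · subst haa
    simp only [and_self, if_true]
    have hinner : ∀ b : Fin n × Fin n,
        ∑ c : Fin n × Fin n, (if a.1 = b.1 ∧ b.2 = c.1 ∧ a.2 = c.2 then (1 : ℂ) else 0) =
          if a.1 = b.1 then 1 else 0 := by
      intro b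
      by_cases hab : a.1 = b.1
      · rw [if_pos hab, Finset.sum_eq_single (b.2, a.2)]
        · simp [hab]
        · rintro ⟨c1, c2⟩ _ hc
          rw [if_neg]
          rintro ⟨_, h2, h3⟩
          exact hc (Prod.ext h2.symm h3.symm)
        · intro h
          exact absurd (Finset.mem_univ _) h
      · rw [if_neg hab]
        exact Finset.sum_eq_zero fun c _ => if_neg fun h => hab h.1
    simp_rw [hinner]
    exact sum_indicator_fst_eq_natCast n a.1
  · rw [if_neg haa]
    refine Finset.sum_eq_zero fun b _ => Finset.sum_eq_zero fun c _ => if_neg ?_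
    rintro ⟨⟨h1, _, h3⟩, ⟨h1', _, h3'⟩⟩
    exact haa (Prod.ext (h1'.trans h1.symm) (h3'.trans h3.symm))

/-- **Second Gram matrix of `⟨n,n,n⟩`** (uniform second marginal). [folklore] -/
theorem gram_matMulTensor_snd (b b' : Fin n × Fin n) :
    ∑ a, ∑ c, (starRingEnd ℂ) (matMulTensor ℂ n n n a b' c) * matMulTensor ℂ n n n a b c =
      if b = b' then (n : ℂ) else 0 := by
  simp only [matMulTensor_apply_eq, conj_indicator_mul_indicator]
  by_cases hbb : b = b'
  · subst hbb
    simp only [and_self, if_true]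
    have hinner : ∀ a : Fin n × Fin n,
        ∑ c : Fin n × Fin n, (if a.1 = b.1 ∧ b.2 = c.1 ∧ a.2 = c.2 then (1 : ℂ) else 0) =
          if b.1 = a.1 then 1 else 0 := by
      intro a
      by_cases hab : a.1 = b.1
      · rw [if_pos hab.symm, Finset.sum_eq_single (b.2, a.2)]
        · simp [hab]
        · rintro ⟨c1, c2⟩ _ hc
          rw [if_neg]
          rintro ⟨_, h2, h3⟩
          exact hc (Prod.ext h2.symm h3.symm)
        · intro h
          exact absurd (Finset.mem_univ _) h
      · rw [if_neg (fun h => hab h.symm)]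
        exact Finset.sum_eq_zero fun c _ => if_neg fun h => hab h.1
    simp_rw [hinner]
    exact sum_indicator_fst_eq_natCast n b.1
  · rw [if_neg hbb]
    refine Finset.sum_eq_zero fun a _ => Finset.sum_eq_zero fun c _ => if_neg ?_
    rintro ⟨⟨h1, h2, _⟩, ⟨h1', h2', _⟩⟩
    exact hbb (Prod.ext (h1'.symm.trans h1) (h2'.trans h2.symm))

/-- **Third Gram matrix of `⟨n,n,n⟩`** (uniform third marginal). [folklore] -/
theorem gram_matMulTensor_thd (c c' : Fin n × Fin n) :
    ∑ a, ∑ b, (starRingEnd ℂ) (matMulTensor ℂ n n n a b c') * matMulTensor ℂ n n n a b c =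
      if c = c' then (n : ℂ) else 0 := by
  simp only [matMulTensor_apply_eq, conj_indicator_mul_indicator]
  by_cases hcc : c = c'
  · subst hcc
    simp only [and_self, if_true]
    have hinner : ∀ a : Fin n × Fin n,
        ∑ b : Fin n × Fin n, (if a.1 = b.1 ∧ b.2 = c.1 ∧ a.2 = c.2 then (1 : ℂ) else 0) =
          if a.2 = c.2 then 1 else 0 := by
      intro a
      by_cases hac : a.2 = c.2
      · rw [if_pos hac, Finset.sum_eq_single (a.1, c.1)]
        · simp [hac]
        · rintro ⟨b1, b2⟩ _ hb
          rw [if_neg]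
          rintro ⟨h1, h2, _⟩
          exact hb (Prod.ext h1.symm h2)
        · intro h
          exact absurd (Finset.mem_univ _) h
      · rw [if_neg hac]
        exact Finset.sum_eq_zero fun b _ => if_neg fun h => hac h.2.2
    simp_rw [hinner]
    exact sum_indicator_snd_eq_natCast n c.2
  · rw [if_neg hcc]
    refine Finset.sum_eq_zero fun a _ => Finset.sum_eq_zero fun b _ => if_neg ?_
    rintro ⟨⟨_, h2, h3⟩, ⟨_, h2', h3'⟩⟩
    exact hcc (Prod.ext (h2'.symm.trans h2) (h3'.symm.trans h3))

/-- `⟨n,n,n⟩` is `1`-concise: its slices in the first leg are linearly independent. [folklore] -/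
theorem concise_matMulTensor_fst (v : Fin n × Fin n → ℂ)
    (h : ∀ b c, ∑ a, v a * matMulTensor ℂ n n n a b c = 0) : v = 0 := by
  funext a₀
  have := h (a₀.1, a₀.2) (a₀.2, a₀.2)
  rw [Finset.sum_eq_single a₀] at this
  · simpa [matMulTensor_apply_eq] using this
  · intro a _ ha
    rw [matMulTensor_apply_eq, if_neg, mul_zero]
    rintro ⟨h1, _, h3⟩
    exact ha (Prod.ext h1 h3)
  · intro h'
    exact absurd (Finset.mem_univ _) h'

/-- `⟨n,n,n⟩` is `2`-concise. [folklore] -/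
theorem concise_matMulTensor_snd (v : Fin n × Fin n → ℂ)
    (h : ∀ a c, ∑ b, v b * matMulTensor ℂ n n n a b c = 0) : v = 0 := by
  funext b₀
  have := h (b₀.1, b₀.2) (b₀.2, b₀.2)
  rw [Finset.sum_eq_single b₀] at this
  · simpa [matMulTensor_apply_eq] using this
  · intro b _ hb
    rw [matMulTensor_apply_eq, if_neg, mul_zero]
    rintro ⟨h1, h2, _⟩
    exact hb (Prod.ext h1.symm h2)
  · intro h'
    exact absurd (Finset.mem_univ _) h'

/-- `⟨n,n,n⟩` is `3`-concise. [folklore] -/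
theorem concise_matMulTensor_thd (v : Fin n × Fin n → ℂ)
    (h : ∀ a b, ∑ c, v c * matMulTensor ℂ n n n a b c = 0) : v = 0 := by
  funext c₀
  have := h (c₀.1, c₀.2) (c₀.1, c₀.1)
  rw [Finset.sum_eq_single c₀] at this
  · simpa [matMulTensor_apply_eq] using this
  · intro c _ hc
    rw [matMulTensor_apply_eq, if_neg, mul_zero]
    rintro ⟨_, h2, h3⟩
    exact hc (Prod.ext h2.symm h3.symm)
  · intro h'
    exact absurd (Finset.mem_univ _) h'

/-- **Bürgisser–Ikenmeyer 2017, Cor. 4.9 (matrix-multiplication half), discharged**: for every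
`n` the orbit of `⟨n,n,n⟩ = matMulTensor ℂ n n n` under `SL_{n²}(ℂ)³` acting factorwise is closed,
i.e. `⟨n,n,n⟩` is polystable. The printed proof (Prop. 4.8: Hilbert–Mumford refined by Luna and
Kempf, the destabilising one-parameter subgroup being forced into the diagonal torus by the torus
`R` of the de Groote stabiliser, then killed by the uniform marginals of the support) is replaced
by the Kempf–Ness route available in the tree: the uniform *quantum* marginals
(`gram_matMulTensor_fst/snd/thd` — the moment-map form of the same combinatorial input) make the
block embedding `emb3 ⟨n,n,n⟩` critical, its `SL_{3n²}`-orbit is closed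
(`isClosed_tensorOrbit_of_critical`), and conciseness of `⟨n,n,n⟩` cuts the `SL³`-orbit out of
it (`isClosed_tripleOrbit_of_gram`). [cite: BurgisserIkenmeyer2017, Cor. 4.9 with §4.2] -/
theorem BurgisserIkenmeyer2017_cor49_matMulTensor_holds :
    BurgisserIkenmeyer2017_cor49_matMulTensor := by
  intro n
  have h := isClosed_tripleOrbit_of_gram (matMulTensor ℂ n n n) (gram_matMulTensor_fst n)
    (gram_matMulTensor_snd n) (gram_matMulTensor_thd n) (concise_matMulTensor_fst n)
    (concise_matMulTensor_snd n) (concise_matMulTensor_thd n)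
  convert h using 1
  ext s
  simp only [Set.mem_range, Set.mem_setOf_eq, Prod.exists]
  constructor
  · rintro ⟨A, B, C, rfl⟩
    exact ⟨A, B, C, A.2, B.2, C.2, rfl⟩
  · rintro ⟨A, B, C, hA, hB, hC, rfl⟩
    exact ⟨⟨A, hA⟩, ⟨B, hB⟩, ⟨C, hC⟩, rfl⟩

end MatMul

end Literature.Computability.AlgebraicComplexity
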